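import Literature.AlgebraicGeometry.Motives.Varieties
import HarnessLib

/-!
# Discharged fact: the point `Spec k` is a smooth projective variety of dimension `0`

`Literature.AlgebraicGeometry.Motives.Varieties` records as a named fact
(`Literature.isSmoothProjective_unit : Prop`) that the monoidal unit `𝟙_ (SchemeOver k) = (Spec k → Spec k)`
of the category of `k`-schemes is a smooth projective geometrically irreducible variety of relative
dimension `0` (`Literature.IsSmoothProjective 0`). This file proves it
(`Literature.AlgebraicGeometry.Motives.isSmoothProjective_unit_holds`), so users holding `(h : isSmoothProjective_unit k)` can
discharge the hypothesis.

## Proof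

The three fields of `Literature.IsSmoothProjective 0 (𝟙_ (SchemeOver k))`:

* *smooth of relative dimension `0`*: the structure morphism is `𝟙 (Spec k)` (Mathlib
  `CategoryTheory.Over.tensorUnit_hom`), an open immersion, hence smooth of relative dimension `0`
  (Hartshorne III Prop. 10.1(a); Mathlib instance
  `[IsOpenImmersion f] : SmoothOfRelativeDimension 0 f`).
* *geometrically irreducible*: a base change of `𝟙 (Spec k)` along `Spec K → Spec k` is an
  isomorphism onto `Spec K`, which is irreducible (`Literature.AlgebraicGeometry.Motives.geometricallyIrreducible_id`).
* *projective over `k`*: the `k`-rational point `[1 : 1 : ⋯ : 1]` of `ℙⁿ_k = Proj k[x₀,…,xₙ]` is the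
  `k`-morphism `Spec k → Spec (k[x₀,…,xₙ]_{x₀})₀ = D₊(x₀) ⊆ ℙⁿ_k` (Hartshorne II Prop. 2.5(b);
  Mathlib `AlgebraicGeometry.Proj.awayι`) given by evaluating degree-`0` fractions at
  `x₀ = ⋯ = xₙ = 1`; it is a section of the structure morphism `ℙⁿ_k → Spec k`, and a section of a
  morphism to the one-point scheme `Spec k` is a closed immersion (Hartshorne II Ex. 4.8(e) for
  the separated morphism `ℙⁿ_k → Spec k`; Mathlib `AlgebraicGeometry.isClosedImmersion_of_comp_eq_id`).
  With `n = 0` this exhibits `Spec k` as projective over `k` in the sense of Hartshorne II.4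
  (Definition p. 103: a closed immersion into some `ℙⁿ` followed by the projection).

## References

* R. Hartshorne, *Algebraic Geometry*, GTM 52, Springer (1977), doi:10.1007/978-1-4757-3849-0:
  Ch. II Prop. 2.5(b) (`D₊(f) ≅ Spec S_(f)`), Ch. II §4 Definition of projective morphisms (p. 103)
  and Ex. 4.8(e), Ch. III Prop. 10.1(a). [Hartshorne1977]
* The Stacks project, Tag 0366 (geometrically irreducible schemes). [StacksProject]
-/

universe u

open CategoryTheory AlgebraicGeometry MonoidalCategory

namespace Literature.AlgebraicGeometry.Motives

/-- The identity of any scheme is geometrically irreducible: a base change of `𝟙 X` along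
`y : Spec K ⟶ X` (`K` a field) is an isomorphism onto `Spec K`, which is irreducible
(trivial case of Stacks 0366 / Hartshorne II Ex. 3.15). [folklore] -/
theorem geometricallyIrreducible_id (X : Scheme.{u}) : GeometricallyIrreducible (𝟙 X) := by
  refine ⟨fun K _ y Z fst snd h ↦ ?_⟩
  have : IsIso snd := h.isIso_snd_of_isIso
  exact snd.homeomorph.irreducibleSpace_iff.mpr inferInstance

section Unit

variable (n : ℕ) (k : Type u) [Field k]

/-- Projective space `ℙⁿ_k` has a `k`-rational point, and it is a closed `k`-immersion
`Spec k ⟶ ℙⁿ_k`: the point `[1 : 1 : ⋯ : 1]`, i.e. `Spec k → Spec (k[x₀,…,xₙ]_{x₀})₀ ≅ D₊(x₀) ⊆ ℙⁿ_k`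
(evaluation of degree-`0` fractions at `xᵢ = 1`), is a section of `ℙⁿ_k → Spec k`, and a section
of a morphism onto the one-point scheme `Spec k` is a closed immersion.
[cite: Hartshorne1977, Ch. II Prop. 2.5(b) and Ch. II Ex. 4.8(e)] -/
theorem exists_unit_hom_projectiveSpace_isClosedImmersion :
    ∃ ι : 𝟙_ (SchemeOver k) ⟶ projectiveSpace n k, IsClosedImmersion ι.left := by
  letI := MvPolynomial.gradedAlgebra (σ := Fin (n + 1)) (R := k)
  let 𝒜 := MvPolynomial.homogeneousSubmodule (Fin (n + 1)) k
  have f_deg : (MvPolynomial.X 0 : MvPolynomial (Fin (n + 1)) k) ∈ 𝒜 1 :=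
    MvPolynomial.isHomogeneous_X k 0
  -- evaluation at `x₀ = ⋯ = xₙ = 1`, under which `x₀` becomes a unit
  let ev : MvPolynomial (Fin (n + 1)) k →+* k := MvPolynomial.eval fun _ => 1
  have hev : IsUnit (ev (MvPolynomial.X 0)) := by simp [ev]
  -- the induced ring map `(k[x₀,…,xₙ]_{x₀})₀ → k[x₀,…,xₙ]_{x₀} → k`
  let φ : HomogeneousLocalization.Away 𝒜 (MvPolynomial.X 0) →+* k :=
    (Localization.awayLift ev (MvPolynomial.X 0) hev).comp
      (algebraMap _ (Localization.Away (MvPolynomial.X 0 : MvPolynomial (Fin (n + 1)) k)))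
  have key : ∀ a : 𝒜 0, φ (HomogeneousLocalization.fromZeroRingHom 𝒜 _ a) = ev a := by
    intro a
    have hval : (HomogeneousLocalization.fromZeroRingHom 𝒜
          (Submonoid.powers (MvPolynomial.X 0)) a).val =
        algebraMap (MvPolynomial (Fin (n + 1)) k) (Localization.Away (MvPolynomial.X 0)) a := by
      simp only [HomogeneousLocalization.fromZeroRingHom, RingHom.coe_mk, MonoidHom.coe_mk,
        OneHom.coe_mk, HomogeneousLocalization.val_mk, Localization.mk_eq_mk',
        IsLocalization.mk'_eq_iff_eq_mul]
      simp
    simp only [φ, RingHom.comp_apply, HomogeneousLocalization.algebraMap_apply, hval]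
    exact IsLocalization.Away.lift_eq _ hev _
  -- `k → k[x₀,…,xₙ]₀ → (k[x₀,…,xₙ]_{x₀})₀ → k` is the identity
  have hφ : φ.comp ((HomogeneousLocalization.fromZeroRingHom 𝒜 _).comp (algebraMap k (𝒜 0))) =
      RingHom.id k := by
    ext c
    simp only [RingHom.comp_apply, RingHom.id_apply, key]
    simp [ev, MvPolynomial.algebraMap_eq]
  -- the rational point, a section of the structure morphism `ℙⁿ_k → Spec k`
  let g : Spec (.of k) ⟶ Proj 𝒜 :=
    Spec.map (CommRingCat.ofHom φ) ≫ Proj.awayι 𝒜 (MvPolynomial.X 0) f_deg zero_lt_one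
  have hg : g ≫ (projectiveSpace n k).hom = 𝟙 _ := by
    simp only [g, projectiveSpace, Over.mk_hom, Category.assoc]
    rw [Proj.awayι_toSpecZero_assoc, ← Spec.map_comp, ← Spec.map_comp, ← CommRingCat.ofHom_comp,
      ← CommRingCat.ofHom_comp, hφ, CommRingCat.ofHom_id]
    exact Spec.map_id _
  exact ⟨Over.homMk g hg, (isClosedImmersion_of_comp_eq_id _ _ hg : IsClosedImmersion g)⟩

/-- `Spec k` is projective over `k`: it admits a closed `k`-immersion into `ℙ⁰_k` (indeed into
every `ℙⁿ_k`, `Literature.AlgebraicGeometry.Motives.exists_unit_hom_projectiveSpace_isClosedImmersion`), so `Spec k → Spec k`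
factors as a closed immersion into `ℙⁿ_k` followed by the projection.
[cite: Hartshorne1977, Ch. II §4 Definition of projective morphisms (p. 103) and Ch. II Ex. 4.8(e)] -/
theorem isProjectiveOver_unit : IsProjectiveOver (𝟙_ (SchemeOver k)) :=
  ⟨0, exists_unit_hom_projectiveSpace_isClosedImmersion 0 k⟩

/-- The structure morphism of `𝟙_ (SchemeOver k)`, namely `𝟙 (Spec k)`, is smooth of relative
dimension `0` (an open immersion is smooth of relative dimension `0`).
[cite: Hartshorne1977, Ch. III Prop. 10.1(a)] -/
theorem smoothOfRelativeDimension_unit : SmoothOfRelativeDimension 0 (𝟙_ (SchemeOver k)).hom :=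
  inferInstanceAs (SmoothOfRelativeDimension 0 (𝟙 (Spec (.of k))))

/-- The structure morphism of `𝟙_ (SchemeOver k)`, namely `𝟙 (Spec k)`, is geometrically
irreducible (`Spec k ×ₖ Spec K = Spec K` is irreducible; Stacks 0366). [folklore] -/
theorem geometricallyIrreducible_unit : GeometricallyIrreducible (𝟙_ (SchemeOver k)).hom :=
  geometricallyIrreducible_id (Spec (.of k))

/-- Discharge of the named fact `Literature.AlgebraicGeometry.Motives.isSmoothProjective_unit`: the point `Spec k = 𝟙_ (SchemeOver k)`
is a smooth projective geometrically irreducible `k`-variety of dimension `0` — smooth of relative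
dimension `0` because `𝟙 (Spec k)` is an open immersion (Hartshorne III Prop. 10.1(a)), projective
because the rational point `Spec k → ℙ⁰_k` is a closed immersion (Hartshorne II §4 Definition
p. 103, II Prop. 2.5(b), II Ex. 4.8(e)), and geometrically irreducible because every base change
`Spec K` of it is irreducible.
[cite: Hartshorne1977, Ch. II §4 Definition of projective morphisms (p. 103); Ch. II Ex. 4.8(e); Ch. III Prop. 10.1(a)] -/
theorem isSmoothProjective_unit_holds : isSmoothProjective_unit k :=
  ⟨smoothOfRelativeDimension_unit k, isProjectiveOver_unit k, geometricallyIrreducible_unit k⟩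

end Unit

end Literature.AlgebraicGeometry.Motives
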